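import Literature.AnabelianGeometry.SemiGraphs.PSCSeparatingCoveringsTwoComponentAffineEdges
import Literature.AnabelianGeometry.SemiGraphs.ProSigmaCompletionQuotientTransfer
import HarnessLib

/-!
# `Ker(Π_G ↠ Π^unr_G)` for data whose edge groups are closures of cyclic images ([CombGC] Def. 1.1 (ii))

Mochizuki, *A combinatorial version of the Grothendieck conjecture*, Tohoku Math. J. **59** (2007)
[CombGC], Def. 1.1 (ii) p. 7: `Π^unr_G` is the quotient of `Π_G` by the closed normal subgroup generated by
the edge-like subgroups (typed `PSCDatum.unrKer`, `PSCFundamentalGroup.lean`)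
[cite: MochizukiCombGC2007, Def 1.1(ii) p.7].  PROOF-ONLY file (abc-iut-f-166 gen 3; door D1 of the
sturdy `Π^unr`-verticial separating covering, row P12-L01-U / FACT row F-2828): for a datum over a
homomorphism `ι : Γ → Π` with DENSE range all of whose edge groups are `cl ι⟨x_e⟩` (the shape of every
genuine datum in the tree: smooth curves, two-component affine data),

* `unrKer_eq_topologicalClosure_map_normalClosure` — **`Ker(Π_G ↠ Π^unr_G) = cl ι(⟨⟨x_e : e⟩⟩)`**, the
  closure of the image of the normal closure in `Γ` of the edge generators;
* `isProSigmaCompletion_unrQuotient` — hence, for `ι` a pro-`Σ` completion, the induced map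
  `Γ ⧸ ⟨⟨x_e⟩⟩ → Π ⧸ Ker(Π_G ↠ Π^unr_G)` is a pro-`Σ` completion (tree brick
  `IsProSigmaCompletion.quotientMap_of_coe_eq_closure`, abc-iut-w5-d195): `Π^unr_G` is the pro-`Σ`
  completion of the discrete unramified quotient `Γ^unr` — at the two-component affine data
  `Γ^unr = Γ_{g,r}/⟨⟨c_j, ε⟩⟩ (≅ Γ_{g₀,0} ∗ Γ_{g−g₀,0})`, where the free-product separation
  `FreeProductSurfaceSeparation.exists_normal_separating_surfaceFreeProduct` lives.

0 definitions; nothing here takes a side on [IUTchIII] Cor. 3.12.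
-/

noncomputable section

namespace Literature.AnabelianGeometry.SemiGraphs

namespace PSCDatum

open scoped Pointwise
open SemiGraphOfAnabelioids (IsProSigmaCompletion)
open SemiGraphOfAnabelioids.IsProSigmaCompletion (normal_topologicalClosure_map quotientMap_of_coe_eq_closure
  le_comap_of_image_subset image_subset_of_coe_eq_closure)

universe u

variable {Γ : Type*} [Group Γ] {P : Type u} [Group P] [TopologicalSpace P] [IsTopologicalGroup P]
  {ι : Γ →* P}

/-- **`Ker(Π_G ↠ Π^unr_G)` as the closure of the image of the discrete normal closure of the edge
generators.**  If `ι : Γ → Π` has dense range and every edge group of `G` is `cl ι⟨x_e⟩`, then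
`G.unrKer = cl ι(⟨⟨x_e : e⟩⟩_Γ)`. [cite: MochizukiCombGC2007, Def 1.1(ii) p.7] -/
theorem unrKer_eq_topologicalClosure_map_normalClosure (hd : DenseRange ι) (G : PSCDatum P)
    (xs : G.graph.N ⊕ G.graph.C → Γ)
    (hx : ∀ e, G.edgeGp e = ((Subgroup.zpowers (xs e)).map ι).topologicalClosure) :
    G.unrKer = ((Subgroup.normalClosure (Set.range xs)).map ι).topologicalClosure := by
  set W : Subgroup P := ((Subgroup.normalClosure (Set.range xs)).map ι).topologicalClosure with hW
  haveI hWn : W.Normal := normal_topologicalClosure_map hd (Subgroup.normalClosure (Set.range xs))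
  -- every edge group lies in `W`
  have hedge : ∀ e, G.edgeGp e ≤ W := fun e => by
    rw [hx e, hW]
    exact Subgroup.topologicalClosure_mono (Subgroup.map_mono
      ((Subgroup.zpowers_le).mpr (Subgroup.subset_normalClosure ⟨e, rfl⟩)))
  -- every generator maps into the normal closure of the edge groups
  have hgen : ∀ e, ι (xs e) ∈ Subgroup.normalClosure
      ((⋃ c, (G.cuspGp c : Set P)) ∪ ⋃ n, (G.nodeGp n : Set P)) := by
    intro e
    apply Subgroup.subset_normalClosure
    have hmem : ι (xs e) ∈ G.edgeGp e := by
      rw [hx e]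
      exact Subgroup.le_topologicalClosure _ (Subgroup.mem_map_of_mem ι (Subgroup.mem_zpowers _))
    rcases e with n | c
    · exact Or.inr (Set.mem_iUnion.mpr ⟨n, hmem⟩)
    · exact Or.inl (Set.mem_iUnion.mpr ⟨c, hmem⟩)
  apply le_antisymm
  · -- `unrKer ≤ W`: `W` is a closed normal subgroup containing every edge group
    refine Subgroup.topologicalClosure_minimal _ ?_ (by rw [hW]; exact Subgroup.isClosed_topologicalClosure _)
    refine Subgroup.normalClosure_le_normal ?_
    rintro y (hy | hy)
    · obtain ⟨c, hc⟩ := Set.mem_iUnion.mp hy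
      exact hedge (Sum.inr c) hc
    · obtain ⟨n, hn⟩ := Set.mem_iUnion.mp hy
      exact hedge (Sum.inl n) hn
  · -- `W ≤ unrKer`: the generators map into the (closed) normal closure of the edge groups
    refine Subgroup.topologicalClosure_minimal _ ?_ (Subgroup.isClosed_topologicalClosure _)
    refine (Subgroup.map_le_iff_le_comap.mpr (Subgroup.normalClosure_le_normal ?_)).trans
      (Subgroup.le_topologicalClosure _)
    rintro _ ⟨e, rfl⟩
    exact hgen e

/-- **`Π^unr_G` is the pro-`Σ` completion of the discrete unramified quotient.**  For `ι : Γ → Π` a pro-`Σ`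
completion and a datum all of whose edge groups are `cl ι⟨x_e⟩`, the induced map
`Γ ⧸ ⟨⟨x_e⟩⟩ → Π ⧸ Ker(Π_G ↠ Π^unr_G)` is a pro-`Σ` completion. [cite: MochizukiCombGC2007, Def 1.1(ii) p.7] -/
theorem isProSigmaCompletion_unrQuotient {Sigma : Set ℕ} (hι : IsProSigmaCompletion Sigma ι)
    (G : PSCDatum P) (xs : G.graph.N ⊕ G.graph.C → Γ)
    (hx : ∀ e, G.edgeGp e = ((Subgroup.zpowers (xs e)).map ι).topologicalClosure) :
    ∃ (_hN : (Subgroup.normalClosure (Set.range xs)).Normal) (_hK : G.unrKer.Normal)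
      (hle : Subgroup.normalClosure (Set.range xs) ≤ G.unrKer.comap ι),
      IsProSigmaCompletion Sigma (QuotientGroup.map (Subgroup.normalClosure (Set.range xs)) G.unrKer ι hle) := by
  have hd : DenseRange ι := hι.dense
  have heq := G.unrKer_eq_topologicalClosure_map_normalClosure hd xs hx
  haveI hK : G.unrKer.Normal := by
    rw [heq]; exact normal_topologicalClosure_map hd _
  have hcoe : (G.unrKer : Set P) = closure (ι '' (Subgroup.normalClosure (Set.range xs) : Set Γ)) := by
    rw [heq, Subgroup.topologicalClosure_coe, Subgroup.coe_map]
  exact ⟨inferInstance, hK, le_comap_of_image_subset (image_subset_of_coe_eq_closure hcoe),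
    quotientMap_of_coe_eq_closure hι _ G.unrKer hcoe⟩

end PSCDatum

end Literature.AnabelianGeometry.SemiGraphs

end
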